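import Summits.CriticalPhenomena.PercolationContinuityZ3.Theorems.PercNearOneGluingNoHeavyLowerTailKnQuestion8CoefficientwiseCoreClassKernelMixTransfer
import HarnessLib

/-!
# KB-MIX with full supply: the invariant generated by ANY domination map, stable under terminal leaves

Support file (`--supports stmt-CriticalPhenomena-4575`, closed), prover `prim-cplus-coupling` (gen 31).  No definitions, no notations, no named facts,
no sorries; standard axioms.  Memo `prim-cplus-coupling/A5-COUPLING-gen31.md` §1.4, §3.  Companions `…CoreClassKernelMix` (the restricted form, supply off
`ℜ = {b ∈ R_a}`), `…CoreClassKernelMixTransfer` (the remainder inequality, shared), `…CoreClassKernelMixLeaf`, `…CoreClassKernelMixFullMain`.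

Setting: middle graph `E`, terminals `a, b`, `C_v(ω) = openCluster (ends '' ω) v`, `P = C_a ω`, `Q = C_b(E∖ω)`, `S = C_a ω ∪ C_b ω`, wall
`T = {b ∉ C_a ω} ∩ {b ∉ C_a(E∖ω)}`.  KB-MIX-FULL (used only as an explicit inequality): for test functions `h, k` and levels `hᵃ, hᵇ ≤ h`, `kᵃ, kᵇ ≤ k`,
  `Σ_{ω ⊆ E} h(S) k(S) + Σ_{ω ∈ T} (hᵃ(P) − hᵇ(Q)) (kᵃ(P) − kᵇ(Q)) ≥ 0`.                                                            (KB-MIX-FULL)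
It is WEAKER than the restricted form of `…CoreClassKernelMix` (more supply) — and the restricted form is FALSE in general (exact witness at
`n_H = 8`: the series composition `Θ(1,2)·Θ(2,2,2,2)`, memo §3), whereas the full form holds in every instance of the census (all two-terminal graphs on
`≤ 7` vertices; `n = 8`, `m ≤ 13`) — yet it enjoys the same closure properties:
* `Coefficientwise.coreClass_kernelMixFull_comm` — terminal symmetry (levels exchanged).
* `Coefficientwise.coreClass_kernelMixFull_of_dom` — ANY domination map (injective on `T`, `ψ ω ⊆ E`, `C_a ω ∪ C_b(E∖ω) ⊆ C_a(ψω) ∪ C_b(ψω)`; properness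
  not needed) gives (KB-MIX-FULL) at all levels.
* `Coefficientwise.coreClass_kernelMixFull_leaf` — the leaf step `(E; a, b) ⟹ (insert e E; a′, b)` (`e = a′a` a new pendant edge), by the SAME transfer
  inequality `coreClass_kernelMix_transfer`.
* `Coefficientwise.coreClass_kernel_nonneg_of_kernelMixFull` — at equal levels it is the core-class kernel, hence CW-PA (`…CoreClassKernelWrapper`).
[cite: KozmaNitzan2024, Questions 8–9 (§5.5 p. 36) (context: the Question-8 pocket covariance programme)]
-/

namespace Summit.CriticalPhenomena.PercolationContinuityZ3.Theorems

open Finset Literature.Probability.Percolation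

namespace Coefficientwise

variable {ι V : Type*}

open Classical in
/-- **KB-MIX-FULL is symmetric in the terminals**: the expression for `(E; b, a)` with levels `(hᵇ, hᵃ; kᵇ, kᵃ)` equals the expression for `(E; a, b)`
with levels `(hᵃ, hᵇ; kᵃ, kᵇ)` (colour swap on the wall). [cite: KozmaNitzan2024, Questions 8–9 (§5.5 p. 36) (context)] -/
theorem coreClass_kernelMixFull_comm (ends : ι → Sym2 V) (E : Finset ι) (a b : V) (h k ha hb ka kb : Set V → ℝ) :
    ((∑ ω ∈ E.powerset,
        h (openCluster (ends '' (↑ω : Set ι)) b ∪ openCluster (ends '' (↑ω : Set ι)) a) *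
          k (openCluster (ends '' (↑ω : Set ι)) b ∪ openCluster (ends '' (↑ω : Set ι)) a))
      + ∑ ω ∈ E.powerset.filter (fun ω : Finset ι => a ∉ openCluster (ends '' (↑ω : Set ι)) b ∧ a ∉ openCluster (ends '' (↑(E \ ω) : Set ι)) b),
        (hb (openCluster (ends '' (↑ω : Set ι)) b) - ha (openCluster (ends '' (↑(E \ ω) : Set ι)) a)) *
          (kb (openCluster (ends '' (↑ω : Set ι)) b) - ka (openCluster (ends '' (↑(E \ ω) : Set ι)) a)))
    = (∑ ω ∈ E.powerset,
        h (openCluster (ends '' (↑ω : Set ι)) a ∪ openCluster (ends '' (↑ω : Set ι)) b) *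
          k (openCluster (ends '' (↑ω : Set ι)) a ∪ openCluster (ends '' (↑ω : Set ι)) b))
      + ∑ ω ∈ E.powerset.filter (fun ω : Finset ι => b ∉ openCluster (ends '' (↑ω : Set ι)) a ∧ b ∉ openCluster (ends '' (↑(E \ ω) : Set ι)) a),
        (ha (openCluster (ends '' (↑ω : Set ι)) a) - hb (openCluster (ends '' (↑(E \ ω) : Set ι)) b)) *
          (ka (openCluster (ends '' (↑ω : Set ι)) a) - kb (openCluster (ends '' (↑(E \ ω) : Set ι)) b)) := by
  set C : Finset ι → V → Set V := fun ω v => openCluster (ends '' (↑ω : Set ι)) v with hC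
  change ((∑ ω ∈ E.powerset, h (C ω b ∪ C ω a) * k (C ω b ∪ C ω a))
      + ∑ ω ∈ E.powerset.filter (fun ω : Finset ι => a ∉ C ω b ∧ a ∉ C (E \ ω) b), (hb (C ω b) - ha (C (E \ ω) a)) * (kb (C ω b) - ka (C (E \ ω) a)))
    = (∑ ω ∈ E.powerset, h (C ω a ∪ C ω b) * k (C ω a ∪ C ω b))
      + ∑ ω ∈ E.powerset.filter (fun ω : Finset ι => b ∉ C ω a ∧ b ∉ C (E \ ω) a), (ha (C ω a) - hb (C (E \ ω) b)) * (ka (C ω a) - kb (C (E \ ω) b))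
  have hidx2 : E.powerset.filter (fun ω : Finset ι => a ∉ C ω b ∧ a ∉ C (E \ ω) b) =
      E.powerset.filter (fun ω : Finset ι => b ∉ C ω a ∧ b ∉ C (E \ ω) a) := by
    ext ω; simp only [Finset.mem_filter, hC, mem_openCluster_comm ends ω a b, mem_openCluster_comm ends (E \ ω) a b]
  rw [hidx2]
  congr 1
  · exact Finset.sum_congr rfl fun ω _ => by rw [Set.union_comm]
  · have hsw := sum_powerset_filter_sdiff E (fun ω : Finset ι => b ∉ C ω a ∧ b ∉ C (E \ ω) a)
      (fun s hs => by rw [Finset.sdiff_sdiff_eq_self hs]; exact and_comm)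
      (fun ω => (hb (C (E \ ω) b) - ha (C ω a)) * (kb (C (E \ ω) b) - ka (C ω a)))
    have e1 : ∑ ω ∈ E.powerset.filter (fun ω : Finset ι => b ∉ C ω a ∧ b ∉ C (E \ ω) a),
        (hb (C ω b) - ha (C (E \ ω) a)) * (kb (C ω b) - ka (C (E \ ω) a)) =
        ∑ ω ∈ E.powerset.filter (fun ω : Finset ι => b ∉ C ω a ∧ b ∉ C (E \ ω) a),
          (hb (C (E \ (E \ ω)) b) - ha (C (E \ ω) a)) * (kb (C (E \ (E \ ω)) b) - ka (C (E \ ω) a)) := by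
      refine Finset.sum_congr rfl fun ω hω => ?_
      rw [Finset.mem_filter, Finset.mem_powerset] at hω
      rw [Finset.sdiff_sdiff_eq_self hω.1]
    rw [e1, hsw]
    exact Finset.sum_congr rfl fun ω _ => by ring

open Classical in
/-- **KB-MIX-FULL from any domination map.**  Middle graph `E`, terminals `a, b`, a map `ψ` with `ψ ω ⊆ E`, injective on the wall event
`{b ∉ C_a ω, b ∉ C_a(E∖ω)}` and `C_a ω ∪ C_b(E∖ω) ⊆ C_a(ψω) ∪ C_b(ψω)` there.  Then for all monotone `h, k` and levels `0 ≤ hᵃ, hᵇ ≤ h`, `0 ≤ kᵃ, kᵇ ≤ k`: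
`0 ≤ Σ_{ω ⊆ E} h(S)k(S) + Σ_{ω : b ∉ C_a ω, b ∉ C_a(E∖ω)} (hᵃ(C_a ω) − hᵇ(C_b(E∖ω)))(kᵃ(C_a ω) − kᵇ(C_b(E∖ω)))` (`S = C_a ω ∪ C_b ω`).
[cite: KozmaNitzan2024, Questions 8–9 (§5.5 p. 36) (context)] -/
theorem coreClass_kernelMixFull_of_dom (ends : ι → Sym2 V) (E : Finset ι) (a b : V) (h k ha hb ka kb : Set V → ℝ)
    (hh : Monotone h) (hk : Monotone k)
    (ha0 : ∀ X, 0 ≤ ha X) (hah : ∀ X, ha X ≤ h X) (hb0 : ∀ X, 0 ≤ hb X) (hbh : ∀ X, hb X ≤ h X)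
    (ka0 : ∀ X, 0 ≤ ka X) (kak : ∀ X, ka X ≤ k X) (kb0 : ∀ X, 0 ≤ kb X) (kbk : ∀ X, kb X ≤ k X)
    (ψ : Finset ι → Finset ι)
    (hψE : ∀ ω, ω ⊆ E → b ∉ openCluster (ends '' (↑ω : Set ι)) a → b ∉ openCluster (ends '' (↑(E \ ω) : Set ι)) a → ψ ω ⊆ E)
    (hψcov : ∀ ω, ω ⊆ E → b ∉ openCluster (ends '' (↑ω : Set ι)) a → b ∉ openCluster (ends '' (↑(E \ ω) : Set ι)) a →
      openCluster (ends '' (↑ω : Set ι)) a ∪ openCluster (ends '' (↑(E \ ω) : Set ι)) b ⊆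
        openCluster (ends '' (↑(ψ ω) : Set ι)) a ∪ openCluster (ends '' (↑(ψ ω) : Set ι)) b)
    (hψinj : ∀ ω₁ ω₂, ω₁ ⊆ E → b ∉ openCluster (ends '' (↑ω₁ : Set ι)) a → b ∉ openCluster (ends '' (↑(E \ ω₁) : Set ι)) a →
      ω₂ ⊆ E → b ∉ openCluster (ends '' (↑ω₂ : Set ι)) a → b ∉ openCluster (ends '' (↑(E \ ω₂) : Set ι)) a → ψ ω₁ = ψ ω₂ → ω₁ = ω₂) :
    0 ≤ (∑ ω ∈ E.powerset,
        h (openCluster (ends '' (↑ω : Set ι)) a ∪ openCluster (ends '' (↑ω : Set ι)) b) *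
          k (openCluster (ends '' (↑ω : Set ι)) a ∪ openCluster (ends '' (↑ω : Set ι)) b))
      + ∑ ω ∈ E.powerset.filter (fun ω : Finset ι => b ∉ openCluster (ends '' (↑ω : Set ι)) a ∧ b ∉ openCluster (ends '' (↑(E \ ω) : Set ι)) a),
        (ha (openCluster (ends '' (↑ω : Set ι)) a) - hb (openCluster (ends '' (↑(E \ ω) : Set ι)) b)) *
          (ka (openCluster (ends '' (↑ω : Set ι)) a) - kb (openCluster (ends '' (↑(E \ ω) : Set ι)) b)) := by
  set C : Finset ι → V → Set V := fun ω v => openCluster (ends '' (↑ω : Set ι)) v with hC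
  set T : Finset (Finset ι) := E.powerset.filter (fun ω => b ∉ C ω a ∧ b ∉ C (E \ ω) a) with hT
  change 0 ≤ (∑ ω ∈ E.powerset, h (C ω a ∪ C ω b) * k (C ω a ∪ C ω b))
    + ∑ ω ∈ T, (ha (C ω a) - hb (C (E \ ω) b)) * (ka (C ω a) - kb (C (E \ ω) b))
  have hTmem : ∀ {ω}, ω ∈ T ↔ ω ⊆ E ∧ b ∉ C ω a ∧ b ∉ C (E \ ω) a := fun {ω} => by
    rw [hT, Finset.mem_filter, Finset.mem_powerset]
  have hh0 : ∀ X, 0 ≤ h X := fun X => le_trans (ha0 X) (hah X)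
  have hk0 : ∀ X, 0 ≤ k X := fun X => le_trans (ka0 X) (kak X)
  set Y : Finset ι → ℝ := fun ω => h (C ω a ∪ C ω b) * k (C ω a ∪ C ω b) with hY
  have hY0 : ∀ ω, 0 ≤ Y ω := fun ω => mul_nonneg (hh0 _) (hk0 _)
  have step : 0 ≤ ∑ ω ∈ T, ((ha (C ω a) - hb (C (E \ ω) b)) * (ka (C ω a) - kb (C (E \ ω) b)) + Y (ψ ω)) := by
    refine Finset.sum_nonneg fun ω hω => ?_
    obtain ⟨s1, r1, b1⟩ := hTmem.mp hω
    have hcov := hψcov ω s1 r1 b1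
    have hPa : C ω a ⊆ C (ψ ω) a ∪ C (ψ ω) b := fun y hy => hcov (Or.inl hy)
    have hQb : C (E \ ω) b ⊆ C (ψ ω) a ∪ C (ψ ω) b := fun y hy => hcov (Or.inr hy)
    have := mul_add_sub_mul_sub_nonneg (A := h (C (ψ ω) a ∪ C (ψ ω) b)) (B := k (C (ψ ω) a ∪ C (ψ ω) b))
      (α := ha (C ω a)) (β := hb (C (E \ ω) b)) (γ := ka (C ω a)) (δ := kb (C (E \ ω) b))
      (ha0 _) (le_trans (hah _) (hh hPa)) (hb0 _) (le_trans (hbh _) (hh hQb))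
      (ka0 _) (le_trans (kak _) (hk hPa)) (kb0 _) (le_trans (kbk _) (hk hQb))
    simp only [hY]; linarith
  have lower : ∑ ω ∈ T, Y (ψ ω) ≤ ∑ ω ∈ E.powerset, Y ω := by
    have hinj : ∀ ω₁ ∈ T, ∀ ω₂ ∈ T, ψ ω₁ = ψ ω₂ → ω₁ = ω₂ := by
      intro ω₁ h₁ ω₂ h₂ he
      obtain ⟨s1, r1, b1⟩ := hTmem.mp h₁
      obtain ⟨s2, r2, b2⟩ := hTmem.mp h₂
      exact hψinj ω₁ ω₂ s1 r1 b1 s2 r2 b2 he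
    have e1 : ∑ ω ∈ T, Y (ψ ω) = ∑ ω' ∈ T.image ψ, Y ω' := (Finset.sum_image (f := fun ω' => Y ω') hinj).symm
    rw [e1]
    refine Finset.sum_le_sum_of_subset_of_nonneg ?_ (fun ω _ _ => hY0 ω)
    intro ω' hω'
    rw [Finset.mem_image] at hω'
    obtain ⟨ω, hω, rfl⟩ := hω'
    obtain ⟨s1, r1, b1⟩ := hTmem.mp hω
    exact Finset.mem_powerset.mpr (hψE ω s1 r1 b1)
  rw [Finset.sum_add_distrib] at step
  have hYsum : ∑ ω ∈ E.powerset, h (C ω a ∪ C ω b) * k (C ω a ∪ C ω b) = ∑ ω ∈ E.powerset, Y ω := rfl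
  rw [hYsum]
  linarith

open Classical in
/-- **KB-MIX-FULL at equal levels is the core-class kernel.**  For a monotone `f` with `f ∅ = 0` and a monotone `g`, if
`0 ≤ Σ_{ω ⊆ E} f(S)(g S − g ∅) + Σ_{ω : b ∉ C_a ω, b ∉ C_a(E∖ω)} (f(C_a ω) − f(C_b(E∖ω)))((g(C_a ω) − g ∅) − (g(C_b(E∖ω)) − g ∅))` then the
core-class kernel of `(E; a, b)` is nonnegative:
`0 ≤ Σ_{ω ⊆ E} f(S)(g S − g ∅) + Σ_{ω : b ∉ C_a ω, b ∉ C_a(E∖ω)} [f(C_a ω)(g(C_a ω) − g(C_b(E∖ω))) + f(C_b ω)(g(C_b ω) − g(C_a(E∖ω)))]`.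
[cite: KozmaNitzan2024, Questions 8–9 (§5.5 p. 36) (context)] -/
theorem coreClass_kernel_nonneg_of_kernelMixFull (ends : ι → Sym2 V) (E : Finset ι) (a b : V) (f g : Set V → ℝ)
    (hmix : 0 ≤ (∑ ω ∈ E.powerset,
        f (openCluster (ends '' (↑ω : Set ι)) a ∪ openCluster (ends '' (↑ω : Set ι)) b) *
          (g (openCluster (ends '' (↑ω : Set ι)) a ∪ openCluster (ends '' (↑ω : Set ι)) b) - g ∅))
      + ∑ ω ∈ E.powerset.filter (fun ω : Finset ι => b ∉ openCluster (ends '' (↑ω : Set ι)) a ∧ b ∉ openCluster (ends '' (↑(E \ ω) : Set ι)) a),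
        (f (openCluster (ends '' (↑ω : Set ι)) a) - f (openCluster (ends '' (↑(E \ ω) : Set ι)) b)) *
          ((g (openCluster (ends '' (↑ω : Set ι)) a) - g ∅) - (g (openCluster (ends '' (↑(E \ ω) : Set ι)) b) - g ∅))) :
    0 ≤ (∑ ω ∈ E.powerset,
        f (openCluster (ends '' (↑ω : Set ι)) a ∪ openCluster (ends '' (↑ω : Set ι)) b) *
          (g (openCluster (ends '' (↑ω : Set ι)) a ∪ openCluster (ends '' (↑ω : Set ι)) b) - g ∅))
      + ∑ ω ∈ E.powerset.filter (fun ω : Finset ι => b ∉ openCluster (ends '' (↑ω : Set ι)) a ∧ b ∉ openCluster (ends '' (↑(E \ ω) : Set ι)) a),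
        (f (openCluster (ends '' (↑ω : Set ι)) a) * (g (openCluster (ends '' (↑ω : Set ι)) a) - g (openCluster (ends '' (↑(E \ ω) : Set ι)) b))
          + f (openCluster (ends '' (↑ω : Set ι)) b) * (g (openCluster (ends '' (↑ω : Set ι)) b) - g (openCluster (ends '' (↑(E \ ω) : Set ι)) a))) := by
  set C : Finset ι → V → Set V := fun ω v => openCluster (ends '' (↑ω : Set ι)) v with hC
  set D : Finset (Finset ι) := E.powerset.filter (fun ω => b ∉ C ω a ∧ b ∉ C (E \ ω) a) with hD
  change 0 ≤ (∑ ω ∈ E.powerset, f (C ω a ∪ C ω b) * (g (C ω a ∪ C ω b) - g ∅)) +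
    ∑ ω ∈ D, (f (C ω a) * (g (C ω a) - g (C (E \ ω) b)) + f (C ω b) * (g (C ω b) - g (C (E \ ω) a)))
  change 0 ≤ (∑ ω ∈ E.powerset, f (C ω a ∪ C ω b) * (g (C ω a ∪ C ω b) - g ∅)) +
    ∑ ω ∈ D, (f (C ω a) - f (C (E \ ω) b)) * ((g (C ω a) - g ∅) - (g (C (E \ ω) b) - g ∅)) at hmix
  have hswap : ∑ ω ∈ D, f (C ω b) * (g (C ω b) - g (C (E \ ω) a)) = ∑ ω ∈ D, f (C (E \ ω) b) * (g (C (E \ ω) b) - g (C ω a)) := by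
    have hs := sum_powerset_filter_sdiff E (fun ω : Finset ι => b ∉ C ω a ∧ b ∉ C (E \ ω) a)
      (fun s hs => by rw [Finset.sdiff_sdiff_eq_self hs]; exact and_comm) (fun ω => f (C ω b) * (g (C ω b) - g (C (E \ ω) a)))
    rw [hD, ← hs]
    refine Finset.sum_congr rfl fun ω hω => ?_
    rw [Finset.mem_filter, Finset.mem_powerset] at hω
    rw [Finset.sdiff_sdiff_eq_self hω.1]
  rw [Finset.sum_add_distrib, hswap, ← Finset.sum_add_distrib]
  have hsym : ∀ ω, f (C ω a) * (g (C ω a) - g (C (E \ ω) b)) + f (C (E \ ω) b) * (g (C (E \ ω) b) - g (C ω a)) =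
      (f (C ω a) - f (C (E \ ω) b)) * ((g (C ω a) - g ∅) - (g (C (E \ ω) b) - g ∅)) := fun ω => by ring
  simp only [hsym]
  exact hmix

open Classical in
/-- **KB-MIX-FULL leaf step.**  Middle graph `E`, terminals `a, b`, a new edge `e ∉ E` with `ends e = s(a′, a)`, `a′` on no edge of `E`, `a′ ≠ a`, `a′ ≠ b`;
monotone test functions `h, k` and monotone levels `0 ≤ hᵃ, hᵇ ≤ h`, `0 ≤ kᵃ, kᵇ ≤ k` on `Set V`.  If
`0 ≤ Σ_{ω ⊆ E} h(a′ ∪ S)k(a′ ∪ S) + Σ_{ω : b ∉ C_a ω, b ∉ C_a(E∖ω)} (hᵃ(a′ ∪ C_a ω) − hᵇ(C_b(E∖ω)))(kᵃ(a′ ∪ C_a ω) − kᵇ(C_b(E∖ω)))`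
then, with `E′ = insert e E`,
`0 ≤ Σ_{ω ⊆ E′} h(C_{a′} ω ∪ C_b ω)k(C_{a′} ω ∪ C_b ω) + Σ_{ω ⊆ E′ : b ∉ C_{a′} ω, b ∉ C_{a′}(E′∖ω)} (hᵃ(C_{a′} ω) − hᵇ(C_b(E′∖ω)))(kᵃ(C_{a′} ω) − kᵇ(C_b(E′∖ω)))`.
[cite: KozmaNitzan2024, Questions 8–9 (§5.5 p. 36) (context)] -/
theorem coreClass_kernelMixFull_leaf (ends : ι → Sym2 V) (E : Finset ι) (e : ι) (a a' b : V) (he : e ∉ E) (hends : ends e = s(a', a))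
    (ha'E : ∀ i ∈ E, a' ∉ ends i) (ha'a : a' ≠ a) (ha'b : a' ≠ b)
    (h k ha hb ka kb : Set V → ℝ) (hh : Monotone h) (hk : Monotone k)
    (mha : Monotone ha) (mhb : Monotone hb) (mka : Monotone ka) (mkb : Monotone kb)
    (ha0 : ∀ X, 0 ≤ ha X) (hah : ∀ X, ha X ≤ h X) (hb0 : ∀ X, 0 ≤ hb X) (hbh : ∀ X, hb X ≤ h X)
    (ka0 : ∀ X, 0 ≤ ka X) (kak : ∀ X, ka X ≤ k X) (kb0 : ∀ X, 0 ≤ kb X) (kbk : ∀ X, kb X ≤ k X)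
    (hmix : 0 ≤ (∑ ω ∈ E.powerset,
        h (insert a' (openCluster (ends '' (↑ω : Set ι)) a ∪ openCluster (ends '' (↑ω : Set ι)) b)) *
          k (insert a' (openCluster (ends '' (↑ω : Set ι)) a ∪ openCluster (ends '' (↑ω : Set ι)) b)))
      + ∑ ω ∈ E.powerset.filter (fun ω : Finset ι => b ∉ openCluster (ends '' (↑ω : Set ι)) a ∧ b ∉ openCluster (ends '' (↑(E \ ω) : Set ι)) a),
        (ha (insert a' (openCluster (ends '' (↑ω : Set ι)) a)) - hb (openCluster (ends '' (↑(E \ ω) : Set ι)) b)) *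
          (ka (insert a' (openCluster (ends '' (↑ω : Set ι)) a)) - kb (openCluster (ends '' (↑(E \ ω) : Set ι)) b))) :
    0 ≤ (∑ ω ∈ (insert e E).powerset,
        h (openCluster (ends '' (↑ω : Set ι)) a' ∪ openCluster (ends '' (↑ω : Set ι)) b) *
          k (openCluster (ends '' (↑ω : Set ι)) a' ∪ openCluster (ends '' (↑ω : Set ι)) b))
      + ∑ ω ∈ (insert e E).powerset.filter (fun ω : Finset ι => b ∉ openCluster (ends '' (↑ω : Set ι)) a' ∧
            b ∉ openCluster (ends '' (↑((insert e E) \ ω) : Set ι)) a'),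
        (ha (openCluster (ends '' (↑ω : Set ι)) a') - hb (openCluster (ends '' (↑((insert e E) \ ω) : Set ι)) b)) *
          (ka (openCluster (ends '' (↑ω : Set ι)) a') - kb (openCluster (ends '' (↑((insert e E) \ ω) : Set ι)) b)) := by
  set C : Finset ι → V → Set V := fun ω v => openCluster (ends '' (↑ω : Set ι)) v with hC
  set E' : Finset ι := insert e E with hE'
  change 0 ≤ (∑ ω ∈ E.powerset, h (insert a' (C ω a ∪ C ω b)) * k (insert a' (C ω a ∪ C ω b)))
      + ∑ ω ∈ E.powerset.filter (fun ω : Finset ι => b ∉ C ω a ∧ b ∉ C (E \ ω) a),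
        (ha (insert a' (C ω a)) - hb (C (E \ ω) b)) * (ka (insert a' (C ω a)) - kb (C (E \ ω) b)) at hmix
  change 0 ≤ (∑ ω ∈ E'.powerset, h (C ω a' ∪ C ω b) * k (C ω a' ∪ C ω b))
      + ∑ ω ∈ E'.powerset.filter (fun ω : Finset ι => b ∉ C ω a' ∧ b ∉ C (E' \ ω) a'),
        (ha (C ω a') - hb (C (E' \ ω) b)) * (ka (C ω a') - kb (C (E' \ ω) b))
  have hCmono : ∀ {ω ω' : Finset ι} (v : V), ω ⊆ ω' → C ω v ⊆ C ω' v := fun v hle => openCluster_image_mono ends hle v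
  have hsdiff_ins : ∀ ω, ω ⊆ E → E' \ insert e ω = E \ ω := by
    intro ω hω; ext i
    simp only [hE', Finset.mem_sdiff, Finset.mem_insert, not_or]
    constructor
    · rintro ⟨h1, h2, h3⟩; rcases h1 with h1 | h1; exact absurd h1 h2; exact ⟨h1, h3⟩
    · rintro ⟨h1, h2⟩; exact ⟨Or.inr h1, fun h3 => he (h3 ▸ h1), h2⟩
  have hsdiff : ∀ ω, ω ⊆ E → E' \ ω = insert e (E \ ω) := by
    intro ω hω; ext i
    simp only [hE', Finset.mem_sdiff, Finset.mem_insert]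
    constructor
    · rintro ⟨h1, h2⟩; rcases h1 with h1 | h1; exact Or.inl h1; exact Or.inr ⟨h1, h2⟩
    · rintro (h1 | ⟨h1, h2⟩); exact ⟨Or.inl h1, fun h3 => he (h1 ▸ hω h3)⟩; exact ⟨Or.inr h1, h2⟩
  have ha'c : ∀ c, c ⊆ E → ∀ i ∈ c, a' ∉ ends i := fun c hc i hi => ha'E i (hc hi)
  have cl_root0 : ∀ c, c ⊆ E → C c a' = {a'} := fun c hc => openCluster_eq_singleton_of_no_edge_at ends c (ha'c c hc)
  have cl_root1 : ∀ c, c ⊆ E → C (insert e c) a' = insert a' (C c a) := fun c hc => openCluster_leaf_root_insert ends c hends (ha'c c hc)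
  have cl_other : ∀ c, c ⊆ E → C (insert e c) b ⊆ C c b ∪ {y | y = a' ∧ a ∈ C c b} :=
    fun c hc => openCluster_leaf_other_insert_subset ends c hends (ha'c c hc) ha'a ha'b.symm
  have cl_other_eq : ∀ c, c ⊆ E → a ∉ C c b → C (insert e c) b = C c b := by
    intro c hc hac
    apply Set.Subset.antisymm
    · intro y hy; rcases cl_other c hc hy with hy' | ⟨_, hy'⟩; exact hy'; exact absurd hy' hac
    · exact hCmono b (Finset.subset_insert e c)
  have cl_union1 : ∀ c, c ⊆ E → C (insert e c) a' ∪ C (insert e c) b = insert a' (C c a ∪ C c b) := by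
    intro c hc
    rw [cl_root1 c hc]
    apply Set.Subset.antisymm
    · intro y hy
      rcases hy with hy | hy
      · rcases hy with hy | hy; exact Or.inl hy; exact Or.inr (Or.inl hy)
      · rcases cl_other c hc hy with hy' | ⟨hy', _⟩; exact Or.inr (Or.inr hy'); exact Or.inl hy'
    · intro y hy
      rcases hy with hy | hy
      · exact Or.inl (Or.inl hy)
      · rcases hy with hy | hy; exact Or.inl (Or.inr hy); exact Or.inr (hCmono b (Finset.subset_insert e c) hy)
  have cl_union0 : ∀ c, c ⊆ E → C c a' ∪ C c b = insert a' (C c b) := by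
    intro c hc; rw [cl_root0 c hc]; rfl
  -- split the two sums along the colour of `e`
  rw [Finset.sum_filter, hE', Finset.sum_powerset_insert he, Finset.sum_powerset_insert he]
  have S0 : ∑ ω ∈ E.powerset, h (C ω a' ∪ C ω b) * k (C ω a' ∪ C ω b) =
      ∑ ω ∈ E.powerset, h (insert a' (C ω b)) * k (insert a' (C ω b)) := by
    refine Finset.sum_congr rfl fun ω hω => ?_
    rw [cl_union0 ω (Finset.mem_powerset.mp hω)]
  have S1 : ∑ ω ∈ E.powerset, h (C (insert e ω) a' ∪ C (insert e ω) b) * k (C (insert e ω) a' ∪ C (insert e ω) b) =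
      ∑ ω ∈ E.powerset, h (insert a' (C ω a ∪ C ω b)) * k (insert a' (C ω a ∪ C ω b)) := by
    refine Finset.sum_congr rfl fun ω hω => ?_
    rw [cl_union1 ω (Finset.mem_powerset.mp hω)]
  have A0 : ∑ ω ∈ E.powerset, (if b ∉ C ω a' ∧ b ∉ C (insert e E \ ω) a' then
        (ha (C ω a') - hb (C (insert e E \ ω) b)) * (ka (C ω a') - kb (C (insert e E \ ω) b)) else 0) =
      ∑ ω ∈ E.powerset, (if a ∉ C (E \ ω) b then (ha {a'} - hb (C (E \ ω) b)) * (ka {a'} - kb (C (E \ ω) b)) else 0) := by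
    refine Finset.sum_congr rfl fun ω hω => ?_
    have hω := Finset.mem_powerset.mp hω
    rw [← hE', hsdiff ω hω, cl_root0 ω hω, cl_root1 (E \ ω) Finset.sdiff_subset]
    have hiff : (b ∉ ({a'} : Set V) ∧ b ∉ insert a' (C (E \ ω) a)) ↔ a ∉ C (E \ ω) b := by
      rw [Set.mem_singleton_iff, Set.mem_insert_iff, mem_openCluster_comm ends (E \ ω) a b]
      constructor
      · rintro ⟨_, hx⟩; exact fun hy => hx (Or.inr hy)
      · intro hx; exact ⟨ha'b.symm, fun hy => hy.elim (fun hz => ha'b.symm hz) hx⟩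
    by_cases hw : a ∉ C (E \ ω) b
    · rw [if_pos (hiff.mpr hw), if_pos hw, cl_other_eq (E \ ω) Finset.sdiff_subset hw]
    · rw [if_neg (fun hx => hw (hiff.mp hx)), if_neg hw]
  have A1 : ∑ ω ∈ E.powerset, (if b ∉ C (insert e ω) a' ∧ b ∉ C (insert e E \ insert e ω) a' then
        (ha (C (insert e ω) a') - hb (C (insert e E \ insert e ω) b)) * (ka (C (insert e ω) a') - kb (C (insert e E \ insert e ω) b)) else 0) =
      ∑ ω ∈ E.powerset, (if b ∉ C ω a then
        (ha (insert a' (C ω a)) - hb (C (E \ ω) b)) * (ka (insert a' (C ω a)) - kb (C (E \ ω) b)) else 0) := by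
    refine Finset.sum_congr rfl fun ω hω => ?_
    have hω := Finset.mem_powerset.mp hω
    rw [← hE', hsdiff_ins ω hω, cl_root1 ω hω, cl_root0 (E \ ω) Finset.sdiff_subset]
    have hiff : (b ∉ insert a' (C ω a) ∧ b ∉ ({a'} : Set V)) ↔ b ∉ C ω a := by
      rw [Set.mem_singleton_iff, Set.mem_insert_iff]
      constructor
      · rintro ⟨hx, _⟩; exact fun hy => hx (Or.inr hy)
      · intro hx; exact ⟨fun hy => hy.elim (fun hz => ha'b.symm hz) hx, ha'b.symm⟩
    by_cases hw : b ∉ C ω a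
    · rw [if_pos (hiff.mpr hw), if_pos hw]
    · rw [if_neg (fun hx => hw (hiff.mp hx)), if_neg hw]
  rw [S0, S1, A0, A1]
  have A1split : ∑ ω ∈ E.powerset, (if b ∉ C ω a then
        (ha (insert a' (C ω a)) - hb (C (E \ ω) b)) * (ka (insert a' (C ω a)) - kb (C (E \ ω) b)) else 0) =
      ∑ ω ∈ E.powerset.filter (fun ω => b ∉ C ω a ∧ b ∉ C (E \ ω) a),
        (ha (insert a' (C ω a)) - hb (C (E \ ω) b)) * (ka (insert a' (C ω a)) - kb (C (E \ ω) b))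
      + ∑ ω ∈ E.powerset, (if b ∉ C ω a ∧ a ∈ C (E \ ω) b then
        (ha (insert a' (C ω a)) - hb (C (E \ ω) b)) * (ka (insert a' (C ω a)) - kb (C (E \ ω) b)) else 0) := by
    rw [Finset.sum_filter, ← Finset.sum_add_distrib]
    refine Finset.sum_congr rfl fun ω _ => ?_
    by_cases h1 : b ∉ C ω a
    · by_cases h2 : a ∈ C (E \ ω) b
      · have h2' : ¬ (b ∉ C (E \ ω) a) := fun hx => hx ((mem_openCluster_comm ends (E \ ω) a b).mpr h2)
        rw [if_pos h1, if_neg (fun hx => h2' hx.2), if_pos ⟨h1, h2⟩]; ring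
      · have h2' : b ∉ C (E \ ω) a := fun hx => h2 ((mem_openCluster_comm ends (E \ ω) a b).mp hx)
        rw [if_pos h1, if_pos ⟨h1, h2'⟩, if_neg (fun hx => h2 hx.2)]; ring
    · rw [if_neg h1, if_neg (fun hx => h1 hx.1), if_neg (fun hx => h1 hx.1)]; ring
  rw [A1split]
  have h1_ge : ∀ X : Set V, h X ≤ h (insert a' X) := fun X => hh (Set.subset_insert _ _)
  have k1_ge : ∀ X : Set V, k X ≤ k (insert a' X) := fun X => hk (Set.subset_insert _ _)
  have hsing : ∀ X : Set V, ({a'} : Set V) ⊆ insert a' X := fun X => Set.singleton_subset_iff.mpr (Set.mem_insert _ _)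
  have htr := coreClass_kernelMix_transfer ends E a b (fun X => h (insert a' X)) (fun X => k (insert a' X))
    (fun X => ha (insert a' X)) hb (fun X => ka (insert a' X)) kb (ha {a'}) (ka {a'})
    (fun X Y hXY => mha (Set.insert_subset_insert hXY)) mhb (fun X Y hXY => mka (Set.insert_subset_insert hXY)) mkb
    (fun X => ha0 _) (fun X => hah _) (fun X => hb0 _) (fun X => le_trans (hbh X) (h1_ge X))
    (fun X => ka0 _) (fun X => kak _) (fun X => kb0 _) (fun X => le_trans (kbk X) (k1_ge X))
    (ha0 _) (fun X => le_trans (hah _) (hh (hsing X))) (ka0 _) (fun X => le_trans (kak _) (hk (hsing X)))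
  linarith

end Coefficientwise

end Summit.CriticalPhenomena.PercolationContinuityZ3.Theorems
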